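import Summits.ResolutionOfSingularities.ResolutionOfSingularities.Theorems.FrobeniusLadderFInjectiveMacaulayficationGermForm
import Summits.ResolutionOfSingularities.ResolutionOfSingularities.Theorems.FrobeniusLadderFInjectiveMacaulayficationSpreadSupportControl
import Literature.AlgebraicGeometry.Resolution.BlowupsFlatBaseChange
import Literature.AlgebraicGeometry.Resolution.BlowupStalkCharts
import Literature.AlgebraicGeometry.Resolution.AffineBlowupUnique
import Literature.AlgebraicGeometry.Resolution.CanonicalResolutionSmoothCentre
import Literature.AlgebraicGeometry.Resolution.GenericFibreResolutionDatum
import Literature.AlgebraicGeometry.Resolution.IdealSheafLemmas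
import Literature.AlgebraicGeometry.Resolution.MarkedIdealsLemmas
import HarnessLib

/-!
# THE ISOLATED STRATUM OF THE F-HALF IS CARRIED BY THE GERM FORM — «GERM ⇒ F-STUB at finitely many closed points»
# (crux `FInjectiveMacaulayfication` stmt-ResolutionOfSingularities-15315, chain w45a, door v37/v38 F-stub
# `LocalFullificationFibreAdmGe4Split.LocalFInjectivizationFibreAdmGe4`; seat res-L1-w45a-stub-2 g7)

[OURS · L1 W4.5a] Support file (`--supports stmt-ResolutionOfSingularities-15315 --as helper`); def-free; NOT a statement of any manuscript;
AI-written (AI review is weaker than expert review).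

WHAT. The registered F-half asks, for an admissible Cohen–Macaulay local blow-up `g : S′ → Spec 𝒪_{X,x}` regular off its closed fibre, for ONE
fibre-supported centre `𝓚 ≠ ⊥` all of whose blowings up are FULL at every point. The census object of record (res-L1-w45a-plan-1 CRUX-PLAN §C) is
the per-point GERM target `GermForm.FInjectivizationGermAt p s` (p596392): a closed-point-cosupported centre on `Spec 𝒪_{S′,s}` all of whose
blowings up are FULL. This file proves that the germ target CARRIES the ISOLATED STRATUM of the stub:

* `exists_centre_full_of_germs` — THE ENGINE (any integral locally Noetherian `S′` over a field of characteristic `p`): if `S′` is regular off a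
  FINITE set `F` of closed points and `FInjectivizationGermAt p b` holds at every `b ∈ F`, then there is `𝓚 ≠ ⊥` on `S′` with `supp 𝓚 ⊆ F`
  such that EVERY blowing up `S″ → S′` along `𝓚` is FULL at EVERY point. Proof: spread each germ centre `𝓚_b ⊆ 𝒪_{S′,b}` to an ideal sheaf
  `J_b` with stalk `𝓚_b` at `b` and support `⊆ {b}` (`SpreadSupportControl`, the `𝔪_b`-primarity coming from the cosupport clause of the germ
  datum), take `𝓚 := ∏_b J_b`; over `b` a blowing up along `𝓚` base-changes along the flat pro-open immersion `Spec 𝒪_{S′,b} → S′` to a blowing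
  up along `𝓚·𝒪_{S′,b} = 𝓚_b` (Görtz–Wedhorn 13.91 (2)), FULL by the germ datum, and the local rings upstairs do not change (Temkin 2008 §2.1);
  off `F` the blowing up is a local isomorphism onto regular, hence FULL, local rings.
* `fHalf_conclusion_of_isolated_of_germs` — the engine in the binders of the F-stub: for the data `(d, p, k, X, f, x, S′, g, I)` of
  `LocalFInjectivizationFibreAdmGe4` (CM hypothesis not even needed), if `S′` is regular off finitely many closed points carrying germ data, the
  stub's conclusion holds (fibre support from properness of `g`: closed points of `S′` lie over the closed point).

READING (census bookkeeping, OURS): the open content of the F-stub splits as «isolated stratum» (Sing S′ finite — REDUCED by this file to rows of the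
germ target at the finitely many singular closed points of `S′`) + «positive-dimensional fibre stratum» (Sing S′ ∩ g⁻¹(x) of positive dimension —
untouched). No claim beyond the kernel.
[folklore assembly; cite: GortzWedhorn2020, Prop. 13.91 (2),(3); Temkin2008, §2.1 (p. 6); StacksProject, Tag 01J7]
-/

-- single-problem summit: the doubled namespace component is forced
set_option linter.dupNamespace false

noncomputable section

namespace Summit.ResolutionOfSingularities.ResolutionOfSingularities.Theorems.FInjectiveMacaulayfication.FHalfIsolatedOfGerms

open CategoryTheory CategoryTheory.Limits AlgebraicGeometry TopologicalSpace IsLocalRing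
open Literature.AlgebraicGeometry.Resolution
open Summit.ResolutionOfSingularities.ResolutionOfSingularities.Theorems.FInjectiveMacaulayfication
open SliceableCentre GermForm

/-! ## §1 Small lemmas on ideal sheaves of a local scheme -/

/-- The ideal sheaf of the zero ideal is the zero ideal sheaf. [folklore] -/
theorem affineBlowup_idealSheaf_bot {R : Type} [CommRing R] : affineBlowup.idealSheaf (⊥ : Ideal R) = ⊥ := by
  apply Scheme.IdealSheafData.ext_of_isAffine
  rw [affineBlowup.idealSheaf, ideal_ofIdealTop_top, Ideal.map_bot, Scheme.IdealSheafData.ideal_bot, Pi.bot_apply]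

/-- If the ideal sheaf `Ĩ` of `I ⊆ O` on the local scheme `Spec O` is cosupported in the closed point, then `√I ⊇ 𝔪`. [folklore] -/
theorem maximalIdeal_le_radical_of_support_subset {O : Type} [CommRing O] [IsLocalRing O] {I : Ideal O}
    {K : (Spec (.of O)).IdealSheafData} (hKI : K = affineBlowup.idealSheaf I)
    (hK : ∀ s ∈ (K.support : Set (Spec (.of O))), s = closedPoint O) :
    maximalIdeal O ≤ I.radical := by
  rw [Ideal.radical_eq_sInf]
  refine le_sInf ?_
  rintro 𝔭 ⟨hI𝔭, h𝔭⟩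
  let y : Spec (.of O) := ⟨𝔭, h𝔭⟩
  have hy : y ∈ (K.support : Set (Spec (.of O))) := by
    rw [hKI, affineBlowup.support_idealSheaf]
    exact hI𝔭
  have h𝔭eq : 𝔭 = maximalIdeal O := congrArg PrimeSpectrum.asIdeal (hK y hy)
  rw [h𝔭eq]

/-- A closed point of a scheme proper over a local scheme lies over the closed point. [folklore] -/
theorem base_eq_closedPoint_of_isClosed {O : CommRingCat.{0}} [IsLocalRing O] {S : Scheme.{0}} (g : S ⟶ Spec O) [IsProper g]
    {s : S} (hs : IsClosed ({s} : Set S)) : g.base s = closedPoint O := by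
  have himg : IsClosed ({g.base s} : Set (Spec O)) := by
    have := g.isClosedMap _ hs
    rwa [Set.image_singleton] at this
  have hmax := (PrimeSpectrum.isClosed_singleton_iff_isMaximal (g.base s)).mp himg
  exact PrimeSpectrum.ext (IsLocalRing.eq_maximalIdeal hmax)

/-! ## §2 The engine: finitely many germ centres spread and multiply to one centre, FULL everywhere after blowing up -/

set_option maxHeartbeats 800000 in
-- a Finset induction building the centre, then a flat base change per bad point
/-- **GERM ⇒ F-STUB ON THE ISOLATED STRATUM (engine).** `S′` integral, locally Noetherian, over a field of characteristic `p`, regular off a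
FINITE set `F` of closed points, with `FInjectivizationGermAt p b` at every `b ∈ F`. Then some `𝓚 ≠ ⊥` with `supp 𝓚 ⊆ F` has ALL its blowings
up FULL at EVERY point. [OURS · folklore assembly; cite: GortzWedhorn2020, Prop. 13.91 (2),(3); Temkin2008, §2.1] -/
theorem exists_centre_full_of_germs (p : ℕ) [Fact p.Prime] {k : Type} [Field k] [CharP k p]
    {S' : Scheme.{0}} [IsIntegral S'] [IsLocallyNoetherian S'] (f₀ : S' ⟶ Spec (.of k))
    (F : Finset S') (hFcl : ∀ b ∈ F, IsClosed ({b} : Set S'))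
    (hreg : ∀ s : S', s ∉ F → s ∈ Scheme.regularLocus S')
    (hgerm : ∀ b ∈ F, FInjectivizationGermAt p b) :
    ∃ 𝓚 : S'.IdealSheafData, 𝓚 ≠ ⊥ ∧ ((𝓚.support : Set S') ⊆ (F : Set S')) ∧
      ∀ (S'' : Scheme.{0}) (π : S'' ⟶ S'), IsBlowup π 𝓚 → ∀ s : S'', FullCl p (S''.presheaf.stalk s) := by
  classical
  -- the germ data
  have hgerm' : ∀ b ∈ F, ∃ 𝓚 : (Spec (S'.presheaf.stalk b)).IdealSheafData, 𝓚 ≠ ⊥ ∧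
      (∀ s ∈ (𝓚.support : Set (Spec (S'.presheaf.stalk b))), s = closedPoint (S'.presheaf.stalk b)) ∧
      ∀ (S'' : Scheme.{0}) (π : S'' ⟶ Spec (S'.presheaf.stalk b)), IsBlowup π 𝓚 →
        ∀ s : S'', FullCl p (S''.presheaf.stalk s) := hgerm
  choose 𝓚g h𝓚g_ne h𝓚g_supp h𝓚g_full using hgerm'
  -- the germ centres are ideal sheaves `Ĩ_b` of ideals `I_b ⊆ 𝒪_{S′,b}`; the stalk ideals to be prescribed
  have hK : ∀ b (hb : b ∈ F), ∃ I : Ideal (S'.presheaf.stalk b), 𝓚g b hb = affineBlowup.idealSheaf I :=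
    fun b hb => affineBlowup.exists_eq_idealSheaf (R := S'.presheaf.stalk b) (𝓚g b hb)
  choose 𝔞' h𝔞' using hK
  let 𝔞 : ∀ b : S', Ideal (S'.presheaf.stalk b) := fun b => if hb : b ∈ F then 𝔞' b hb else ⊤
  have h𝔞 : ∀ b (hb : b ∈ F), 𝔞 b = 𝔞' b hb := fun b hb => dif_pos hb
  have h𝔞K : ∀ b (hb : b ∈ F), affineBlowup.idealSheaf (𝔞 b) = 𝓚g b hb := fun b hb => by
    rw [h𝔞 b hb]; exact (h𝔞' b hb).symm
  -- one spread per bad point, supported at that point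
  have hspread : ∀ b ∈ F, ∃ J : S'.IdealSheafData, stalkIdeal J b = 𝔞 b ∧ (J.support : Set S') ⊆ {b} := by
    intro b hb
    obtain ⟨n, c, hc⟩ := Submodule.fg_iff_exists_fin_generating_family.mp (IsNoetherian.noetherian (𝔞 b))
    have hrad : stalkIdeal (Scheme.IdealSheafData.vanishingIdeal ⟨{b}, hFcl b hb⟩) b ≤ (Ideal.span (Set.range c)).radical := by
      refine le_trans ((mem_support_iff_stalkIdeal_le _ b).mp ?_) ?_
      · rw [← SetLike.mem_coe, Scheme.IdealSheafData.coe_support_vanishingIdeal]; exact Set.mem_singleton b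
      · have hc' : Ideal.span (Set.range c) = 𝔞 b := hc
        rw [hc', h𝔞 b hb]
        exact maximalIdeal_le_radical_of_support_subset (h𝔞' b hb) (h𝓚g_supp b hb)
    obtain ⟨J, hJ, hJsupp⟩ := SpreadSupportControl.exists_spread_support_subset_of_le_radical {b} (hFcl b hb) c hrad
    refine ⟨J, ?_, hJsupp⟩
    rw [hJ]; exact hc
  choose Jb hJb_stalk hJb_supp using hspread
  -- the product centre, by induction on the set of treated points
  have hbuild : ∀ U : Finset S', U ⊆ F → ∃ 𝓚 : S'.IdealSheafData, ((𝓚.support : Set S') ⊆ (U : Set S')) ∧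
      ∀ b ∈ U, stalkIdeal 𝓚 b = 𝔞 b := by
    intro U
    induction U using Finset.induction with
    | empty => intro _; exact ⟨⊤, by simp [Scheme.IdealSheafData.support_top], by simp⟩
    | insert b U hbU ih =>
      intro hUF
      obtain ⟨𝓚, h𝓚supp, h𝓚st⟩ := ih ((Finset.subset_insert b U).trans hUF)
      have hb : b ∈ F := hUF (Finset.mem_insert_self b U)
      refine ⟨𝓚 * Jb b hb, ?_, ?_⟩
      · intro s hs
        rw [Scheme.IdealSheafData.support_mul, TopologicalSpace.Closeds.coe_sup] at hs
        rcases hs with hs | hs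
        · exact Finset.mem_coe.mpr (Finset.mem_insert_of_mem (Finset.mem_coe.mp (h𝓚supp hs)))
        · have := hJb_supp b hb hs
          rw [Set.mem_singleton_iff] at this
          simp [this]
      · intro b' hb'
        rcases Finset.mem_insert.mp hb' with h | hb'U
        · rw [h]
          have hnot : b ∉ 𝓚.support := fun h' => hbU (Finset.mem_coe.mp (h𝓚supp h'))
          rw [stalkIdeal_mul, stalkIdeal_eq_top_of_not_mem_support hnot, Ideal.top_mul]
          exact hJb_stalk b hb
        · have hne : b' ≠ b := fun h => hbU (h ▸ hb'U)
          have hnot : b' ∉ (Jb b hb).support := fun h => hne (Set.mem_singleton_iff.mp (hJb_supp b hb h))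
          rw [stalkIdeal_mul, stalkIdeal_eq_top_of_not_mem_support hnot, Ideal.mul_top]
          exact h𝓚st b' hb'U
  obtain ⟨𝓚, h𝓚supp, h𝓚st⟩ := hbuild F le_rfl
  -- `𝓚 ≠ ⊥`
  have h𝓚ne : 𝓚 ≠ ⊥ := by
    rcases F.eq_empty_or_nonempty with hF | ⟨b, hb⟩
    · intro h0
      have huniv : ((𝓚.support : Set S')) = Set.univ := by
        rw [h0, Scheme.IdealSheafData.support_bot, TopologicalSpace.Closeds.coe_top]
      have hgen : genericPoint S' ∈ (𝓚.support : Set S') := by rw [huniv]; trivial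
      have := h𝓚supp hgen
      rw [hF] at this
      simp at this
    · intro h0
      have hst : 𝔞' b hb = ⊥ := by rw [← h𝔞 b hb, ← h𝓚st b hb, h0]; exact stalkIdeal_bot b
      apply h𝓚g_ne b hb
      rw [h𝔞' b hb, hst]
      exact affineBlowup_idealSheaf_bot
  refine ⟨𝓚, h𝓚ne, h𝓚supp, fun S'' π hπ s => ?_⟩
  haveI : CharP (S''.presheaf.stalk s) p := FTemkinClosedPoints.charP_stalk_of_over p f₀ π s
  by_cases hs : π s ∈ F
  · -- over a bad point `b`: flat base change to `Spec 𝒪_{S′,b}`, a blowing up along the germ centre `𝓚_b`, FULL by the germ datum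
    haveI : Flat (S'.fromSpecStalk (π s)) := flat_fromSpecStalk S' (π s)
    have hbl : IsBlowup (pullback.snd π (S'.fromSpecStalk (π s))) (𝓚g (π s) hs) := by
      have h := hπ.pullback_snd_of_flat (S'.fromSpecStalk (π s))
      rwa [comap_fromSpecStalk_eq_affineBlowupIdealSheaf, h𝓚st (π s) hs, h𝔞K (π s) hs] at h
    have hrange : s ∈ Set.range (pullback.fst π (S'.fromSpecStalk (π s))) :=
      mem_range_pullback_fst_fromSpecStalk_of_eq π (π s) rfl
    obtain ⟨t, ht⟩ := hrange
    have htfull : FullCl p ((pullback π (S'.fromSpecStalk (π s))).presheaf.stalk t) := h𝓚g_full (π s) hs _ _ hbl t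
    haveI := isIso_stalkMap_of_flat_of_isPreimmersion (pullback.fst π (S'.fromSpecStalk (π s))) t
    have := FTemkinClosedPoints.fullCl_of_isIso_stalkMap p (pullback.fst π (S'.fromSpecStalk (π s))) t htfull
    rwa [ht] at this
  · -- elsewhere: `π` is a local isomorphism onto a regular local ring
    have h2 : π s ∉ (𝓚.support : Set S') := fun h => hs (h𝓚supp h)
    haveI := hπ.isIso_compl
    haveI := isIso_stalkMap_of_isIso_morphismRestrict π ⟨(𝓚.support : Set S')ᶜ, 𝓚.support.isClosed.isOpen_compl⟩ s h2
    have hreg' := (Scheme.mem_regularLocus _).mp (hreg _ hs)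
    haveI := hreg'
    haveI : CharP (S'.presheaf.stalk (π s)) p := FTemkinClosedPoints.charP_stalk_of_over p f₀ (𝟙 S') (π s)
    exact FTemkinClosedPoints.fullCl_of_isIso_stalkMap' p π s (FTemkinClosedPoints.fullCl_of_isRegularLocalRing p _)

/-! ## §3 In the binders of the F-stub: the isolated stratum of `LocalFInjectivizationFibreAdmGe4` -/

set_option maxHeartbeats 400000 in
/-- **THE ISOLATED STRATUM OF THE F-HALF FROM GERM ROWS.** In the data of `LocalFullificationFibreAdmGe4Split.LocalFInjectivizationFibreAdmGe4`
(`X/k` integral, locally of finite type, `char k = p`, any point `x`, a blowing up `g : S′ → Spec 𝒪_{X,x}` along `I ≠ ⊥` — the stub's other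
binders `d ≥ 4`, separated, quasi-compact, `x` closed singular of local dimension `d`, `I` admissible are simply not needed), suppose `S′` is regular off a FINITE set `F` of closed points each of which carries a germ datum
`FInjectivizationGermAt p b`. Then the F-half's conclusion holds for `(S′, g)`: a fibre-supported `𝓚 ≠ ⊥` all of whose blowings up are FULL at
every point. (The hypotheses «regular off the closed fibre» and «CM everywhere» of the stub are implied by / not needed under «regular off `F`».)
[OURS · folklore assembly; cite: GortzWedhorn2020, Prop. 13.91; Temkin2008, §2.1] -/
theorem fHalf_conclusion_of_isolated_of_germs (p : ℕ) (hp : p.Prime) (k : Type) [Field k] [CharP k p]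
    (X : Scheme.{0}) (f : X ⟶ Spec (.of k)) [LocallyOfFiniteType f] [IsIntegral X] (x : X)
    (S' : Scheme.{0}) (g : S' ⟶ Spec (X.presheaf.stalk x)) (I : (Spec (X.presheaf.stalk x)).IdealSheafData)
    (hI : I ≠ ⊥) (hg : IsBlowup g I)
    (F : Finset S') (hFcl : ∀ b ∈ F, IsClosed ({b} : Set S'))
    (hreg : ∀ s : S', s ∉ F → s ∈ Scheme.regularLocus S')
    (hgerm : ∀ b ∈ F, FInjectivizationGermAt p b) :
    ∃ 𝓚 : S'.IdealSheafData, 𝓚 ≠ ⊥ ∧ (∀ s ∈ (𝓚.support : Set S'), g.base s = closedPoint (X.presheaf.stalk x)) ∧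
      ∀ (S'' : Scheme.{0}) (π : S'' ⟶ S'), IsBlowup π 𝓚 → ∀ s : S'', FullCl p (S''.presheaf.stalk s) := by
  haveI : Fact p.Prime := ⟨hp⟩
  haveI : IsLocallyNoetherian X := LocallyOfFiniteType.isLocallyNoetherian f
  haveI : IsIntegral S' := hg.isIntegral hI
  haveI : IsProper g := hg.isProper
  haveI : IsLocallyNoetherian S' := LocallyOfFiniteType.isLocallyNoetherian g
  obtain ⟨𝓚, h𝓚ne, h𝓚supp, h𝓚full⟩ :=
    exists_centre_full_of_germs p (g ≫ X.fromSpecStalk x ≫ f) F hFcl hreg hgerm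
  exact ⟨𝓚, h𝓚ne, fun s hs => base_eq_closedPoint_of_isClosed g (hFcl s (h𝓚supp hs)), h𝓚full⟩

end Summit.ResolutionOfSingularities.ResolutionOfSingularities.Theorems.FInjectiveMacaulayfication.FHalfIsolatedOfGerms

end
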